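import Mathlib
import Summits.Ventures.FusionMHD.Models.FluxSurfacePolarRay
import Summits.Ventures.FusionMHD.Models.RouteACosineDictionary
import HarnessLib

/-!
# Route-A enclosure objects ↦ the polar-ray consumer lane: the boundary-normalised chart, the `(s^k − 1)` ansatz,
# its FREE `s`-derivatives, the ray-profile glue, and the `C⁰` envelopes from `ℓ¹_ν` coefficient balls

LADDER-GRIDFUSION (fusion WATCH, F2 → F3 consumer contract; `pub/gridfusion/models/model-7/g11/F3-WATCH-NOTE-2.md` §0–§1),
cell `gridfusion`, seat `gridfusion-model-7` (g11), 2026-08-28.  A MODEL-SIDE tool file ([folklore] calculus), 0 kit.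

THE OBJECT.  certnum's route A (`pub/certnum/ode/F2-ROUTE-A.md` §0, §1 (b), §4 (A)) encloses an axisymmetric flux function in the
BOUNDARY-NORMALISED POLAR chart about the magnetic axis `(R_a, 0)`:
`(s, θ) ↦ (R, Z) = (R_a + s·ρ(θ)·cos θ, s·ρ(θ)·sin θ)`, `ρ > 0` the polar radius of the plasma boundary, with the ansatz
`Ψ̃(s, θ) = Σ_{k<K} f_k(θ)·(s^{k+1} − 1)` (Dirichlet datum `Ψ̃(1, ·) = 0` built in; `K = 4` on the planted rung) and each
`f_k = cosEval a_k` a cosine series whose coefficient sequence lies in an `ℓ¹_ν` ball `‖a_k − ā_k‖_ν ≤ r_k`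
(`Literature.Analysis.ValidatedNumerics.WeightedEllOne`, [cite: HungriaLessardMirelesJames2016, §2.1 (1.2)]).
Interior flux surfaces are NOT `s = const`: they are the level sets of `Ψ̃`, i.e. the RAY ROOTS of the tree's polar-ray lane
`Models/FluxSurfacePolarRay.lean` (`PolarRay.rayProfile`, `PolarRay.existsUnique_rayRoot`; Freidberg (6.35) as a θ-integral,
`PolarRay.safetyFactorE_eq_polar`) with polar radius `r = s·ρ(θ)`.

WHAT IS PROVED (elementary; every statement is about arbitrary data `f`, `ρ`, `Ψ`):
* §1 `psiTilde`, `psiTildeDs`, `psiTildeDss` and `hasDerivAt_psiTilde`, `hasDerivAt_psiTildeDs`: the `s`-derivatives of the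
  ansatz are the FINITE sums `Σ (k+1) f_k s^k`, `Σ (k+1)k f_k s^{k−1}` — no truncation, no weight factor; `psiTilde_one`.
* §2 `ChartRep Ψ R_a ρ Ψ̃` (the representation identity on `0 ≤ s ≤ 1`) ⇒ `rayProfile Ψ R_a 0 θ r = Ψ̃(r/ρ θ, θ)` on
  `0 ≤ r ≤ ρ θ` (`ChartRep.rayProfile_eq`), the ray derivative WITHIN the ray segment is `D_r = Ψ̃_s/ρ`
  (`ChartRep.hasDerivWithinAt_rayProfile`), continuity and strict monotonicity of the ray profile from `Ψ̃_s > 0`, and the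
  RAY-ROOT certificate shape in chart variables (`ChartRep.existsUnique_rayRoot`: a sign change of `Ψ̃ − c` between
  `s₁ < s₂` in `[0, 1]` plus `Ψ̃_s > 0` on `(s₁, s₂)` ⇒ exactly one point of the surface `Ψ = c` on the ray segment
  `[s₁ρ, s₂ρ]`) — the hypotheses an interval certificate checks box by box.
* §3 ENVELOPES: from pointwise widths `|f_k(θ) − f̄_k(θ)| ≤ r_k` (for cosine-series coefficient balls `‖a_k − ā_k‖_ν ≤ r_k`
  this is `RouteA.abs_cosEval_sub_le` of `Models/RouteACosineDictionary.lean`; `envelope_of_balls`), hence `|Ψ̃ − Ψ̄̃| ≤ Σ r_k (1 − s^{k+1})` on `0 ≤ s ≤ 1` (ZERO at the boundary),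
  `|Ψ̃_s − Ψ̄̃_s| ≤ Σ (k+1) r_k s^k` and `|Ψ̃_ss − Ψ̄̃_ss| ≤ Σ (k+1)k r_k s^{k−1}` on `0 ≤ s`
  (`abs_psiTilde_sub_le`, `abs_psiTildeDs_sub_le`, `abs_psiTildeDss_sub_le`), and the monotonicity test a Bench file runs:
  `Ψ̄̃_s(s, θ) > Σ (k+1) r_k s^k ⇒ Ψ̃_s(s, θ) > 0` (`psiTildeDs_pos_of_envelope`).
* The `θ`-derivative (`C¹`) dictionary the GGJ/Mercier consumers need (F3-WATCH-NOTE-2 §1 row 4) is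
  `Models/RouteACosineDictionary.lean` §2 (`dcosEval`, `IsDerivWeight`, `abs_dcosEval_sub_le`).
* §2b THE `θ`-DIRECTION: `ChartRep.hasDerivAt_theta` (`Ψ̃_θ = sρ′D_r + sρD_t`, via `PolarRay.hasDerivAt_comp_loop`),
  `ChartRep.tangentialDeriv_eq` (`D_t = (Ψ̃_θ − sρ′D_r)/(sρ)`), `ChartRep.hasDerivAt_rayProfile` (interior points) and
  **`ChartRep.gradSq_eq_chart`**: `ψ_R² + ψ_Z² = (Ψ̃_s/ρ)² + ((Ψ̃_θ − sρ′Ψ̃_s/ρ)/(sρ))²` — `|∇Ψ|²` (hence `B_p`, `B²`, the GGJ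
  weights) is chart data of `θ`-order ONE.
NOT HERE (honest): curvature / second `θ`-derivatives of the chart (ballooning consumers); any instance; any value.
MODELLED: nothing (pure calculus about a chart); whether a given enclosure's `Ψ̃` represents a Grad–Shafranov solution is the
producer's certified sentence, carried as the hypothesis `ChartRep`.
FILING LABEL (director-gridfusion g12, HOME INBOX 2026-08-28T17:37:53Z): consumer glue for certnum route-A objects (F3-WATCH-NOTE-2 §0–§1); WATCH lane, RULING 70 (7); no s–α content, no ★ row.
-/

noncomputable section

open Real Set Finset
open Literature.Analysis.ValidatedNumerics.WeightedEllOne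

namespace Summit.Ventures.FusionMHD.Models

namespace RouteA

/-! ## §1 The `(s^k − 1)` ansatz and its free `s`-derivatives -/

/-- The route-A ansatz `Ψ̃(s, θ) = Σ_{k<K} f_k(θ)·(s^{k+1} − 1)` (Dirichlet datum at `s = 1` built in;
certnum F2-ROUTE-A §4 (A) with `K = 4`). [folklore] -/
def psiTilde (K : ℕ) (f : ℕ → ℝ → ℝ) (s θ : ℝ) : ℝ := ∑ k ∈ range K, f k θ * (s ^ (k + 1) - 1)

/-- `∂_s Ψ̃ = Σ_{k<K} (k+1)·f_k(θ)·s^k` (exact: the `s`-dependence is a finite polynomial). [folklore] -/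
def psiTildeDs (K : ℕ) (f : ℕ → ℝ → ℝ) (s θ : ℝ) : ℝ := ∑ k ∈ range K, f k θ * ((k + 1 : ℝ) * s ^ k)

/-- `∂_s² Ψ̃ = Σ_{k<K} (k+1)k·f_k(θ)·s^{k−1}`. [folklore] -/
def psiTildeDss (K : ℕ) (f : ℕ → ℝ → ℝ) (s θ : ℝ) : ℝ :=
  ∑ k ∈ range K, f k θ * ((k + 1 : ℝ) * k * s ^ (k - 1))

/-- The boundary `s = 1` is a level set: `Ψ̃(1, θ) = 0`. [folklore] -/
theorem psiTilde_one (K : ℕ) (f : ℕ → ℝ → ℝ) (θ : ℝ) : psiTilde K f 1 θ = 0 := by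
  simp [psiTilde]

/-- At the chart centre `Ψ̃(0, θ) = −Σ f_k(θ)`. [folklore] -/
theorem psiTilde_zero (K : ℕ) (f : ℕ → ℝ → ℝ) (θ : ℝ) : psiTilde K f 0 θ = -∑ k ∈ range K, f k θ := by
  simp [psiTilde, Finset.sum_neg_distrib]

/-- `s ↦ Ψ̃(s, θ)` has derivative `Ψ̃_s(s, θ)`. [folklore] -/
theorem hasDerivAt_psiTilde (K : ℕ) (f : ℕ → ℝ → ℝ) (θ s : ℝ) :
    HasDerivAt (fun s => psiTilde K f s θ) (psiTildeDs K f s θ) s := by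
  unfold psiTilde psiTildeDs
  refine HasDerivAt.fun_sum fun k _ => ?_
  have h : HasDerivAt (fun s : ℝ => s ^ (k + 1) - 1) ((k + 1 : ℕ) * s ^ k) s := by
    simpa using (hasDerivAt_pow (k + 1) s).sub_const 1
  have := h.const_mul (f k θ)
  simpa [Nat.cast_add, Nat.cast_one] using this

/-- `s ↦ Ψ̃_s(s, θ)` has derivative `Ψ̃_ss(s, θ)`. [folklore] -/
theorem hasDerivAt_psiTildeDs (K : ℕ) (f : ℕ → ℝ → ℝ) (θ s : ℝ) :
    HasDerivAt (fun s => psiTildeDs K f s θ) (psiTildeDss K f s θ) s := by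
  unfold psiTildeDs psiTildeDss
  refine HasDerivAt.fun_sum fun k _ => ?_
  have h : HasDerivAt (fun s : ℝ => (k + 1 : ℝ) * s ^ k) ((k + 1 : ℝ) * ((k : ℕ) * s ^ (k - 1))) s :=
    (hasDerivAt_pow k s).const_mul _
  have := h.const_mul (f k θ)
  simpa [mul_assoc] using this

/-- `s ↦ Ψ̃(s, θ)` is continuous. [folklore] -/
theorem continuous_psiTilde (K : ℕ) (f : ℕ → ℝ → ℝ) (θ : ℝ) : Continuous fun s => psiTilde K f s θ :=
  continuous_iff_continuousAt.2 fun s => (hasDerivAt_psiTilde K f θ s).continuousAt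

/-- `Ψ̃_s > 0` on `(s₁, s₂)` makes `s ↦ Ψ̃(s, θ)` strictly increasing on `[s₁, s₂]`. [folklore] -/
theorem strictMonoOn_psiTilde {K : ℕ} {f : ℕ → ℝ → ℝ} {θ s₁ s₂ : ℝ}
    (hpos : ∀ s ∈ Ioo s₁ s₂, 0 < psiTildeDs K f s θ) :
    StrictMonoOn (fun s => psiTilde K f s θ) (Icc s₁ s₂) := by
  refine strictMonoOn_of_deriv_pos (convex_Icc s₁ s₂) (continuous_psiTilde K f θ).continuousOn ?_
  intro s hs
  rw [interior_Icc] at hs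
  rw [(hasDerivAt_psiTilde K f θ s).deriv]
  exact hpos s hs

/-! ## §2 The boundary-normalised polar chart and the ray profile of the polar-ray lane -/

/-- `Ψ` is REPRESENTED by `Ψ̃` in the boundary-normalised polar chart about `(R_a, 0)` with boundary radius `ρ`:
`ρ > 0` and `Ψ(R_a + sρ(θ)cos θ, sρ(θ)sin θ) = Ψ̃(s, θ)` for `0 ≤ s ≤ 1` (certnum F2-ROUTE-A §1 (b): the map of record;
the identity is the producer's certified sentence). [folklore] -/
def ChartRep (Ψ : ℝ → ℝ → ℝ) (Ra : ℝ) (ρ : ℝ → ℝ) (Ψt : ℝ → ℝ → ℝ) : Prop :=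
  (∀ θ, 0 < ρ θ) ∧ ∀ θ s, 0 ≤ s → s ≤ 1 → Ψ (Ra + s * ρ θ * cos θ) (s * ρ θ * sin θ) = Ψt s θ

namespace ChartRep

variable {Ψ : ℝ → ℝ → ℝ} {Ra : ℝ} {ρ : ℝ → ℝ} {Ψt : ℝ → ℝ → ℝ}

/-- The boundary radius is positive. [folklore] -/
theorem pos (h : ChartRep Ψ Ra ρ Ψt) (θ : ℝ) : 0 < ρ θ := h.1 θ

/-- The representation identity on `0 ≤ s ≤ 1`. [folklore] -/
theorem rep (h : ChartRep Ψ Ra ρ Ψt) (θ s : ℝ) (hs0 : 0 ≤ s) (hs1 : s ≤ 1) :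
    Ψ (Ra + s * ρ θ * cos θ) (s * ρ θ * sin θ) = Ψt s θ := h.2 θ s hs0 hs1

/-- Along the ray of the polar-ray lane (`PolarRay.rayProfile`, polar radius `r`): `Ψ(ray r) = Ψ̃(r/ρ(θ), θ)` for
`0 ≤ r ≤ ρ(θ)`. [folklore] -/
theorem rayProfile_eq (h : ChartRep Ψ Ra ρ Ψt) {θ r : ℝ} (hr0 : 0 ≤ r) (hr1 : r ≤ ρ θ) :
    PolarRay.rayProfile Ψ Ra 0 θ r = Ψt (r / ρ θ) θ := by
  have hρ := h.pos θ
  have hs := h.rep θ (r / ρ θ) (div_nonneg hr0 hρ.le) ((div_le_one hρ).2 hr1)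
  rw [div_mul_cancel₀ r hρ.ne'] at hs
  simpa [PolarRay.rayProfile] using hs

/-- The ray profile agrees with `r ↦ Ψ̃(r/ρ, θ)` on the ray segment `[0, ρ(θ)]`. [folklore] -/
theorem eqOn_rayProfile (h : ChartRep Ψ Ra ρ Ψt) (θ : ℝ) :
    EqOn (PolarRay.rayProfile Ψ Ra 0 θ) (fun r => Ψt (r / ρ θ) θ) (Icc 0 (ρ θ)) :=
  fun _ hr => h.rayProfile_eq hr.1 hr.2

/-- RAY DERIVATIVE in the chart: if `s ↦ Ψ̃(s, θ)` has derivative `D` at `s = r/ρ(θ)`, the ray profile has derivative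
`D/ρ(θ)` at `r` within the ray segment (`D_r = Ψ̃_s/ρ`). [folklore] -/
theorem hasDerivWithinAt_rayProfile (h : ChartRep Ψ Ra ρ Ψt) {θ r D : ℝ} (hr0 : 0 ≤ r) (hr1 : r ≤ ρ θ)
    (hD : HasDerivAt (fun s => Ψt s θ) D (r / ρ θ)) :
    HasDerivWithinAt (PolarRay.rayProfile Ψ Ra 0 θ) (D / ρ θ) (Icc 0 (ρ θ)) r := by
  have hρ := h.pos θ
  have hdiv : HasDerivAt (fun r : ℝ => r / ρ θ) (1 / ρ θ) r := by
    simpa using (hasDerivAt_id r).div_const (ρ θ)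
  have hcomp : HasDerivAt (fun r : ℝ => Ψt (r / ρ θ) θ) (D * (1 / ρ θ)) r := by
    have hc := hD.comp r hdiv
    simpa only [Function.comp_def] using hc
  have e : D * (1 / ρ θ) = D / ρ θ := by ring
  rw [← e]
  exact hcomp.hasDerivWithinAt.congr_of_mem (fun x hx => h.rayProfile_eq hx.1 hx.2) ⟨hr0, hr1⟩

/-- The ray profile is continuous on every sub-segment `[s₁ρ, s₂ρ] ⊆ [0, ρ]` when `s ↦ Ψ̃(s, θ)` is continuous.
[folklore] -/
theorem continuousOn_rayProfile (h : ChartRep Ψ Ra ρ Ψt) {θ s₁ s₂ : ℝ} (h0 : 0 ≤ s₁) (h1 : s₂ ≤ 1)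
    (hc : Continuous fun s => Ψt s θ) :
    ContinuousOn (PolarRay.rayProfile Ψ Ra 0 θ) (Icc (s₁ * ρ θ) (s₂ * ρ θ)) := by
  have hρ := h.pos θ
  have hsub : Icc (s₁ * ρ θ) (s₂ * ρ θ) ⊆ Icc 0 (ρ θ) := by
    intro r hr
    exact ⟨le_trans (mul_nonneg h0 hρ.le) hr.1, le_trans hr.2 (by nlinarith)⟩
  have hg : ContinuousOn (fun r : ℝ => Ψt (r / ρ θ) θ) (Icc (s₁ * ρ θ) (s₂ * ρ θ)) :=
    (hc.comp (continuous_id.div_const (ρ θ))).continuousOn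
  exact hg.congr fun r hr => h.rayProfile_eq (hsub hr).1 (hsub hr).2

/-- Strict monotonicity transfers from chart variable to polar radius: if `s ↦ Ψ̃(s, θ)` is strictly increasing on
`[s₁, s₂] ⊆ [0, 1]`, the ray profile is strictly increasing on `[s₁ρ, s₂ρ]`. [folklore] -/
theorem strictMonoOn_rayProfile (h : ChartRep Ψ Ra ρ Ψt) {θ s₁ s₂ : ℝ} (h0 : 0 ≤ s₁) (h1 : s₂ ≤ 1)
    (hm : StrictMonoOn (fun s => Ψt s θ) (Icc s₁ s₂)) :
    StrictMonoOn (PolarRay.rayProfile Ψ Ra 0 θ) (Icc (s₁ * ρ θ) (s₂ * ρ θ)) := by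
  have hρ := h.pos θ
  intro a ha b hb hab
  have ha' : 0 ≤ a ∧ a ≤ ρ θ := ⟨le_trans (mul_nonneg h0 hρ.le) ha.1, le_trans ha.2 (by nlinarith [hb.1])⟩
  have hb' : 0 ≤ b ∧ b ≤ ρ θ := ⟨le_trans (mul_nonneg h0 hρ.le) hb.1, le_trans hb.2 (by nlinarith [hb.1])⟩
  rw [h.rayProfile_eq ha'.1 ha'.2, h.rayProfile_eq hb'.1 hb'.2]
  refine hm ⟨?_, ?_⟩ ⟨?_, ?_⟩ (div_lt_div_of_pos_right hab hρ)
  · exact (le_div_iff₀ hρ).2 ha.1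
  · exact (div_le_iff₀ hρ).2 ha.2
  · exact (le_div_iff₀ hρ).2 hb.1
  · exact (div_le_iff₀ hρ).2 hb.2

/-- **RAY-ROOT CERTIFICATE SHAPE IN CHART VARIABLES.**  For the ansatz `Ψ̃ = psiTilde K f`: a sign change
`Ψ̃(s₁, θ) < c < Ψ̃(s₂, θ)` with `0 ≤ s₁ ≤ s₂ ≤ 1` and `Ψ̃_s > 0` on `(s₁, s₂)` give EXACTLY ONE point of the flux
surface `Ψ = c` on the ray segment `[s₁ρ(θ), s₂ρ(θ)]` (the polar-ray lane's `existsUnique_rayRoot`, fed through the chart).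
[folklore] -/
theorem existsUnique_rayRoot {K : ℕ} {f : ℕ → ℝ → ℝ} (h : ChartRep Ψ Ra ρ (psiTilde K f))
    {θ s₁ s₂ c : ℝ} (h0 : 0 ≤ s₁) (h12 : s₁ ≤ s₂) (h1 : s₂ ≤ 1)
    (hpos : ∀ s ∈ Ioo s₁ s₂, 0 < psiTildeDs K f s θ)
    (hlo : psiTilde K f s₁ θ < c) (hhi : c < psiTilde K f s₂ θ) :
    ∃! r, r ∈ Icc (s₁ * ρ θ) (s₂ * ρ θ) ∧ PolarRay.rayProfile Ψ Ra 0 θ r = c := by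
  have hρ := h.pos θ
  refine PolarRay.existsUnique_rayRoot (mul_le_mul_of_nonneg_right h12 hρ.le)
    (h.continuousOn_rayProfile h0 h1 (continuous_psiTilde K f θ))
    (h.strictMonoOn_rayProfile h0 h1 (strictMonoOn_psiTilde hpos)) ?_ ?_
  · rw [h.rayProfile_eq (mul_nonneg h0 hρ.le) (by nlinarith), mul_div_cancel_right₀ s₁ hρ.ne']
    exact hlo
  · rw [h.rayProfile_eq (by nlinarith [mul_nonneg h0 hρ.le]) (by nlinarith), mul_div_cancel_right₀ s₂ hρ.ne']
    exact hhi

/-- … and the ray derivative of the lane along the segment is `psiTildeDs/ρ` (the slope field `D` of the LEVEL files,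
`D(θ, r) = Ψ̃_s(r/ρ(θ), θ)/ρ(θ)`). [folklore] -/
theorem hasDerivWithinAt_rayProfile_psiTilde {K : ℕ} {f : ℕ → ℝ → ℝ} (h : ChartRep Ψ Ra ρ (psiTilde K f))
    {θ r : ℝ} (hr0 : 0 ≤ r) (hr1 : r ≤ ρ θ) :
    HasDerivWithinAt (PolarRay.rayProfile Ψ Ra 0 θ) (psiTildeDs K f (r / ρ θ) θ / ρ θ) (Icc 0 (ρ θ)) r :=
  h.hasDerivWithinAt_rayProfile hr0 hr1 (hasDerivAt_psiTilde K f θ (r / ρ θ))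


/-- Interior points of the ray segment: the within-derivative upgrades to a plain derivative `D_r = Ψ̃_s/ρ` (so the polar-ray
lane's `radialDeriv_eq_of_hasDerivAt` identifies it with `D_r = ψ_R cos θ + ψ_Z sin θ`). [folklore] -/
theorem hasDerivAt_rayProfile (h : ChartRep Ψ Ra ρ Ψt) {θ r D : ℝ} (hr0 : 0 < r) (hr1 : r < ρ θ)
    (hD : HasDerivAt (fun s => Ψt s θ) D (r / ρ θ)) :
    HasDerivAt (PolarRay.rayProfile Ψ Ra 0 θ) (D / ρ θ) r :=
  (h.hasDerivWithinAt_rayProfile hr0.le hr1.le hD).hasDerivAt (Icc_mem_nhds hr0 hr1)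

/-- THE `θ`-DIRECTION CHAIN RULE through the chart: at fixed `s ∈ [0, 1]`,
`∂_θ Ψ̃(s, θ) = sρ′·D_r + sρ·D_t` with the polar-ray lane's `D_r = ψ_R cos θ + ψ_Z sin θ`, `D_t = −ψ_R sin θ + ψ_Z cos θ`
(`(ψ_R, ψ_Z) = (L(1,0), L(0,1))` for the Fréchet derivative `L` of `Ψ` at the chart point; `PolarRay.hasDerivAt_comp_loop` for
the loop of radius `sρ`). [folklore] -/
theorem hasDerivAt_theta (h : ChartRep Ψ Ra ρ Ψt) {s θ ρ' : ℝ} (hs0 : 0 ≤ s) (hs1 : s ≤ 1)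
    (hρ : HasDerivAt ρ ρ' θ) {L : ℝ × ℝ →L[ℝ] ℝ}
    (hΨ : HasFDerivAt (fun p : ℝ × ℝ => Ψ p.1 p.2) L (Ra + s * ρ θ * cos θ, s * ρ θ * sin θ)) :
    HasDerivAt (fun t => Ψt s t)
      (s * ρ' * PolarRay.radialDeriv (L (1, 0)) (L (0, 1)) θ
        + s * ρ θ * PolarRay.tangentialDeriv (L (1, 0)) (L (0, 1)) θ) θ := by
  have hρs : HasDerivAt (fun t => s * ρ t) (s * ρ') θ := hρ.const_mul s
  have hpt : PolarRay.loop Ra 0 (fun t => s * ρ t) θ = (Ra + s * ρ θ * cos θ, s * ρ θ * sin θ) := by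
    simp only [PolarRay.loop, zero_add]
  have hΨ' : HasFDerivAt (fun p : ℝ × ℝ => Ψ p.1 p.2) L (PolarRay.loop Ra 0 (fun t => s * ρ t) θ) := by
    rw [hpt]; exact hΨ
  have hc := PolarRay.hasDerivAt_comp_loop hρs hΨ'
  have e : (fun t => Ψ (PolarRay.loop Ra 0 (fun t => s * ρ t) t).1 (PolarRay.loop Ra 0 (fun t => s * ρ t) t).2)
      = fun t => Ψt s t := by
    funext t
    simp only [PolarRay.loop, zero_add]
    exact h.rep t s hs0 hs1
  rw [e] at hc
  exact hc

/-- … solved for the TANGENTIAL derivative: `D_t = (Ψ̃_θ − sρ′·D_r)/(sρ)` for `0 < s ≤ 1` (with `D_r = Ψ̃_s/ρ` this is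
`D_t = (Ψ̃_θ − s(ρ′/ρ)Ψ̃_s)/(sρ)`, F3-WATCH-NOTE-2 §0); hence `|∇Ψ|² = D_r² + D_t²` (`PolarRay.gradSq_eq`) is chart data of
`θ`-order one. [folklore] -/
theorem tangentialDeriv_eq (h : ChartRep Ψ Ra ρ Ψt) {s θ ρ' T : ℝ} (hs0 : 0 < s) (hs1 : s ≤ 1)
    (hρ : HasDerivAt ρ ρ' θ) {L : ℝ × ℝ →L[ℝ] ℝ}
    (hΨ : HasFDerivAt (fun p : ℝ × ℝ => Ψ p.1 p.2) L (Ra + s * ρ θ * cos θ, s * ρ θ * sin θ))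
    (hT : HasDerivAt (fun t => Ψt s t) T θ) :
    PolarRay.tangentialDeriv (L (1, 0)) (L (0, 1)) θ
      = (T - s * ρ' * PolarRay.radialDeriv (L (1, 0)) (L (0, 1)) θ) / (s * ρ θ) := by
  have hρ0 := h.pos θ
  have huniq : T = s * ρ' * PolarRay.radialDeriv (L (1, 0)) (L (0, 1)) θ
      + s * ρ θ * PolarRay.tangentialDeriv (L (1, 0)) (L (0, 1)) θ :=
    hT.unique (h.hasDerivAt_theta hs0.le hs1 hρ hΨ)
  have hsρ : s * ρ θ ≠ 0 := mul_ne_zero hs0.ne' hρ0.ne'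
  rw [eq_div_iff hsρ, huniq]
  ring

/-- **`|∇Ψ|²` IN CHART DATA** at an interior chart point (`0 < s < 1`): with `D = Ψ̃_s(s, θ)` and `T = Ψ̃_θ(s, θ)`,
`ψ_R² + ψ_Z² = (D/ρ)² + ((T − sρ′·D/ρ)/(sρ))²`. [folklore] -/
theorem gradSq_eq_chart (h : ChartRep Ψ Ra ρ Ψt) {s θ ρ' T D : ℝ} (hs0 : 0 < s) (hs1 : s < 1)
    (hρ : HasDerivAt ρ ρ' θ) {L : ℝ × ℝ →L[ℝ] ℝ}
    (hΨ : HasFDerivAt (fun p : ℝ × ℝ => Ψ p.1 p.2) L (Ra + s * ρ θ * cos θ, s * ρ θ * sin θ))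
    (hT : HasDerivAt (fun t => Ψt s t) T θ) (hD : HasDerivAt (fun s => Ψt s θ) D s) :
    L (1, 0) ^ 2 + L (0, 1) ^ 2 = (D / ρ θ) ^ 2 + ((T - s * ρ' * (D / ρ θ)) / (s * ρ θ)) ^ 2 := by
  have hρ0 := h.pos θ
  -- D_r = D/ρ : derivative of the ray profile at r = sρ, two ways
  have hr0 : 0 < s * ρ θ := mul_pos hs0 hρ0
  have hr1 : s * ρ θ < ρ θ := by nlinarith
  have hD' : HasDerivAt (fun s => Ψt s θ) D (s * ρ θ / ρ θ) := by
    rw [mul_div_cancel_right₀ s hρ0.ne']; exact hD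
  have hray := h.hasDerivAt_rayProfile hr0 hr1 hD'
  -- the same derivative from the Fréchet derivative along the ray `r ↦ (Ra + r cos θ, r sin θ)`
  have hl : HasDerivAt (fun r : ℝ => ((Ra + r * cos θ, 0 + r * sin θ) : ℝ × ℝ)) (cos θ, sin θ) (s * ρ θ) := by
    refine HasDerivAt.prodMk ?_ ?_
    · simpa using ((hasDerivAt_id (s * ρ θ)).mul_const (cos θ)).const_add Ra
    · simpa using ((hasDerivAt_id (s * ρ θ)).mul_const (sin θ)).const_add (0 : ℝ)
  have hpt : ((Ra + s * ρ θ * cos θ, 0 + s * ρ θ * sin θ) : ℝ × ℝ) = (Ra + s * ρ θ * cos θ, s * ρ θ * sin θ) := by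
    rw [zero_add]
  have hΨ' : HasFDerivAt (fun p : ℝ × ℝ => Ψ p.1 p.2) L ((Ra + s * ρ θ * cos θ, 0 + s * ρ θ * sin θ) : ℝ × ℝ) := by
    rw [hpt]; exact hΨ
  have hc' := hΨ'.comp_hasDerivAt (s * ρ θ) hl
  have hc : HasDerivAt (PolarRay.rayProfile Ψ Ra 0 θ) (L (cos θ, sin θ)) (s * ρ θ) := by
    have e : (fun r : ℝ => Ψ ((Ra + r * cos θ, 0 + r * sin θ) : ℝ × ℝ).1 ((Ra + r * cos θ, 0 + r * sin θ) : ℝ × ℝ).2)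
        = PolarRay.rayProfile Ψ Ra 0 θ := by
      funext r; simp [PolarRay.rayProfile]
    rw [← e]; exact hc'
  have hDr : PolarRay.radialDeriv (L (1, 0)) (L (0, 1)) θ = D / ρ θ := by
    have hLe : L (cos θ, sin θ) = PolarRay.radialDeriv (L (1, 0)) (L (0, 1)) θ := by
      have e : ((cos θ, sin θ) : ℝ × ℝ) = (cos θ) • ((1 : ℝ), (0 : ℝ)) + (sin θ) • ((0 : ℝ), (1 : ℝ)) := by
        ext <;> simp
      rw [e, map_add, map_smul, map_smul, smul_eq_mul, smul_eq_mul]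
      unfold PolarRay.radialDeriv; ring
    rw [← hLe]; exact hc.unique hray
  have hDt := h.tangentialDeriv_eq hs0 hs1.le hρ hΨ hT
  rw [PolarRay.gradSq_eq (L (1, 0)) (L (0, 1)) θ, hDr, hDt, hDr]

end ChartRep

/-! ## §3 Envelopes: pointwise widths of `f_k`, `Ψ̃`, `Ψ̃_s`, `Ψ̃_ss` from `ℓ¹_ν` coefficient balls -/

section Envelopes

variable {ν : ℝ}

variable {K : ℕ} {f fbar : ℕ → ℝ → ℝ} {r : ℕ → ℝ}

/-- `Ψ̃`-WIDTH on `0 ≤ s ≤ 1`: pointwise widths `|f_k − f̄_k| ≤ r_k` give `|Ψ̃ − Ψ̄̃| ≤ Σ_{k<K} r_k (1 − s^{k+1})` — ZERO at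
the boundary `s = 1`, `Σ r_k` at the centre. [folklore] -/
theorem abs_psiTilde_sub_le (hf : ∀ k < K, ∀ θ, |f k θ - fbar k θ| ≤ r k) {s θ : ℝ} (hs0 : 0 ≤ s) (hs1 : s ≤ 1) :
    |psiTilde K f s θ - psiTilde K fbar s θ| ≤ ∑ k ∈ range K, r k * (1 - s ^ (k + 1)) := by
  unfold psiTilde
  rw [← Finset.sum_sub_distrib]
  refine (Finset.abs_sum_le_sum_abs _ _).trans (Finset.sum_le_sum fun k hk => ?_)
  have hk' := hf k (Finset.mem_range.1 hk) θ
  have hsk : 0 ≤ 1 - s ^ (k + 1) := sub_nonneg.2 (pow_le_one₀ hs0 hs1)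
  rw [← sub_mul, abs_mul, show |s ^ (k + 1) - 1| = 1 - s ^ (k + 1) by
    rw [abs_sub_comm]; exact abs_of_nonneg hsk]
  exact mul_le_mul_of_nonneg_right hk' hsk

/-- `Ψ̃_s`-WIDTH on `0 ≤ s`: `|Ψ̃_s − Ψ̄̃_s| ≤ Σ_{k<K} (k+1) r_k s^k` (no weight factor: `s`-derivatives are free).
[folklore] -/
theorem abs_psiTildeDs_sub_le (hf : ∀ k < K, ∀ θ, |f k θ - fbar k θ| ≤ r k) {s θ : ℝ} (hs0 : 0 ≤ s) :
    |psiTildeDs K f s θ - psiTildeDs K fbar s θ| ≤ ∑ k ∈ range K, r k * ((k + 1 : ℝ) * s ^ k) := by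
  unfold psiTildeDs
  rw [← Finset.sum_sub_distrib]
  refine (Finset.abs_sum_le_sum_abs _ _).trans (Finset.sum_le_sum fun k hk => ?_)
  have hk' := hf k (Finset.mem_range.1 hk) θ
  have hsk : 0 ≤ (k + 1 : ℝ) * s ^ k := by positivity
  rw [← sub_mul, abs_mul, abs_of_nonneg hsk]
  exact mul_le_mul_of_nonneg_right hk' hsk

/-- `Ψ̃_ss`-WIDTH on `0 ≤ s`: `|Ψ̃_ss − Ψ̄̃_ss| ≤ Σ_{k<K} (k+1)k r_k s^{k−1}`. [folklore] -/
theorem abs_psiTildeDss_sub_le (hf : ∀ k < K, ∀ θ, |f k θ - fbar k θ| ≤ r k) {s θ : ℝ} (hs0 : 0 ≤ s) :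
    |psiTildeDss K f s θ - psiTildeDss K fbar s θ| ≤ ∑ k ∈ range K, r k * ((k + 1 : ℝ) * k * s ^ (k - 1)) := by
  unfold psiTildeDss
  rw [← Finset.sum_sub_distrib]
  refine (Finset.abs_sum_le_sum_abs _ _).trans (Finset.sum_le_sum fun k hk => ?_)
  have hk' := hf k (Finset.mem_range.1 hk) θ
  have hsk : 0 ≤ (k + 1 : ℝ) * k * s ^ (k - 1) := by positivity
  rw [← sub_mul, abs_mul, abs_of_nonneg hsk]
  exact mul_le_mul_of_nonneg_right hk' hsk

/-- THE MONOTONICITY TEST a Bench file runs on a box: if the MIDPOINT slope beats the envelope,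
`Ψ̄̃_s(s, θ) > Σ (k+1) r_k s^k`, then the true slope is positive, `Ψ̃_s(s, θ) > 0` (feeds `strictMonoOn_psiTilde` /
`ChartRep.existsUnique_rayRoot`). [folklore] -/
theorem psiTildeDs_pos_of_envelope (hf : ∀ k < K, ∀ θ, |f k θ - fbar k θ| ≤ r k) {s θ : ℝ} (hs0 : 0 ≤ s)
    (htest : ∑ k ∈ range K, r k * ((k + 1 : ℝ) * s ^ k) < psiTildeDs K fbar s θ) :
    0 < psiTildeDs K f s θ := by
  have h := abs_psiTildeDs_sub_le hf hs0 (θ := θ)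
  have h' := (abs_sub_lt_iff.1 (lt_of_le_of_lt h htest)).2
  linarith

/-- The envelope hypothesis of this section from coefficient balls: if every `f_k = cosEval a_k`, `f̄_k = cosEval ā_k` with
`‖a_k − ā_k‖_ν ≤ r_k` (`ν ≥ 1`), then `|f_k(θ) − f̄_k(θ)| ≤ r_k` for all `k < K` and all `θ`. [cite: HungriaLessardMirelesJames2016, §2.1 (1.2)] -/
theorem envelope_of_balls (hν : 1 ≤ ν) {a abar : ℕ → ℕ → ℝ} (ha : ∀ k < K, Mem ν (a k))
    (habar : ∀ k < K, Mem ν (abar k)) (hr : ∀ k < K, wnorm ν (a k - abar k) ≤ r k)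
    (hf : ∀ k < K, ∀ θ, f k θ = cosEval (a k) θ) (hfbar : ∀ k < K, ∀ θ, fbar k θ = cosEval (abar k) θ) :
    ∀ k < K, ∀ θ, |f k θ - fbar k θ| ≤ r k := by
  intro k hk θ
  rw [hf k hk θ, hfbar k hk θ]
  exact abs_cosEval_sub_le hν (ha k hk) (habar k hk) (hr k hk) θ

end Envelopes

end RouteA

end Summit.Ventures.FusionMHD.Models

end
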